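import Summits.QuantumFields.YangMills.Theorems.BalabanUVNodesN19JointLawPriceRidge

/-!
# YM-DAG node N19 (= NE7 proper) — BETWEEN RIDGE AND GENERAL: a LIPSCHITZ LINK of an ADDITIVE POLYNOMIAL STATISTIC `h(Σ_i p_i(x_i))` is priced
# LINEARLY in `d` under uniform mixed moments (`2πK_h dB∕m + G_h·m9^m·(Λ∕B)^{2m}·r`; at `r ≤ (m²9^m(Λ∕B)^{2m})⁻¹`: `(2πK_h dB + G_h)∕m`)

Cell `pub-ymgap`, HUMAN RULING D-0062 (Track A) ∕ D-0149 (work-bound push), R141 (C) wider-strategy seat `pub-ymgap-dag-n19-e` (strategy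
s3 = ALTERNATIVE CURRENCY), generation g27, module 5 (lineage module 110).  Route `Summits/QuantumFields/YangMills/Theses/BalabanUVNodes.lean`,
cluster item K3⁸ «SpineGivenEndpointR13SepCoPHV» (stmt-QuantumFields-27366); filed `--supports` that item `--as helper` (it proves no registered
stub).  COUNT-NEUTRAL: [folklore] bookkeeping over Mathlib and the lineage BY NAME — module 63 `…N19UniformMomentPriceTwoSided`
(`abs_integral_sub_integral_le_of_moments_jackson`, the one-dimensional Jackson pricing with a degree cut-off), p568465 `…N19JointLawBernstein`
(`abs_integral_prod_eval_sub_le`, `integrable_of_continuous_of_cube`), p555512∕module 61 coefficient-mass lemmas (`sum_abs_coeff_X_mul_le`,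
`sum_abs_coeff_C_mul`, `sum_abs_coeff_one`, `sum_abs_coeff_finsetSum_le`), module 108 `…N19JointLawPriceRidge` (`prod_apply_eq_prod_pow_card`);
no scheme object used, no Theses import; NOT a discharge claim.

CONTEXT (modules 107–109 of this generation).  Under uniform mixed-moment closeness `r` (`L = log r⁻¹`) the joint-law price of `d = |ι|` strings is
`Θ(d²∕(d + L))` for general ℓ¹-Lipschitz functionals (module 107) and `Θ(A∕L)` for RIDGE functionals `h(Σ_i a_i x_i)` (module 108).  This module
prices the next structured class: a Lipschitz LINK `h` of an ADDITIVE POLYNOMIAL STATISTIC `S(x) = Σ_i p_i(x_i)` (`deg p_i ≤ D`, coefficient mass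
`Λ_D(p_i) = Σ_{k≤D}|[x^k]p_i| ≤ Λ`, `|p_i| ≤ B ≤ Λ` on `[−1,1]`) — e.g. `h(Σ_i T_D(x_i))` — and finds it LINEAR in `d` again: the factor `d` of module
107 is paid for genuinely non-additive inner structure.
§1 COEFFICIENT MASS IS SUBMULTIPLICATIVE: `sum_abs_coeff_X_pow_mul_le` · ★ `sum_abs_coeff_mul_le` (`Λ_d(pq) ≤ Λ_a(p)Λ_d(q)`, `deg p ≤ a`) ·
   `sum_abs_coeff_pow_le` (`Λ_d(p^c) ≤ Λ_a(p)^c`).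
§2 POWERS OF THE STATISTIC (fibres by module 108's `prod_apply_eq_prod_pow_card`): `statPow_eq_sum` (`S^n = Σ_{f : Fin n → ι} ∏_i p_i(x_i)^{#f⁻¹(i)}`) · ★ `abs_integral_statPow_sub_le`
   (`|∫S^n dP − ∫S^n dQ| ≤ (dΛ)^n·r` — each term is a product over coordinates of one-variable polynomials of degree `≤ nD`, priced by p568465's
   `abs_integral_prod_eval_sub_le` with §1).
§3 ★★ `law_price_link_le_of_uniformMixedMoments`: `|∫h(S) dP − ∫h(S) dQ| ≤ 2πK_h dB∕m + G_h·(m9^m)·(Λ∕B)^{2m}·r` for every `m ≥ 1` — the push-forwards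
   under `S∕(dB)` are laws on `[−1,1]` whose `j`-th moments are `(Λ∕B)^j r`-close (§2), priced by module 63's cut-off Jackson bound on the profile
   `s ↦ h(dBs)`; ★ `law_price_link_le_of_small` (at `r ≤ (m²·9^m·(Λ∕B)^{2m})⁻¹`: `≤ (2πK_h dB + G_h)∕m`, i.e. `≍ d·B·K_h·log(9Λ²∕B²)∕L` — LINEAR in `d`,
   the inner complexity entering through `log(Λ∕B)` only).
READING (honest): `h(Σ_i T_D(∏os_i))`-type functionals of `d` strings converge at `≍ d·D∕log R_K⁻¹` under the uniform target, like sums and ridge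
functionals and unlike the general class; for LIPSCHITZ (non-polynomial) inner functions `φ_i` one more approximation (`φ_i ≈ p_i`, `deg ≍ √L`) gives
`O(d∕√L)` — NOT typed here, lower bound unknown beyond the ridge `d∕L` (CURRENCY-MAP v6 open item).

HONEST FRAMING (binding).  Elementary and [folklore]; TOY laws; NO consumer in the DAG today (an optimality map of the seat's own currency); nothing of
Bałaban's instantiated; NE7 NOT PRINTED, NOT proved; N19 NOT discharged; count-neutral.  One finite `T⁴` programme at fixed `ε`; nothing continuum ∕
`ℝ⁴` ∕ OS ∕ mass-gap ∕ Clay.  0 `def` ∕ 0 `sorry`.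
-/

noncomputable section

open Real Finset MeasureTheory Polynomial

namespace Summit.QuantumFields.YangMills.Theorems.BalabanUVNodesN19JointLawPriceCompositions

open Summit.QuantumFields.YangMills.Theorems.BalabanUVNodesN19UniformMomentPriceTwoSided (abs_integral_sub_integral_le_of_moments_jackson)
open Summit.QuantumFields.YangMills.Theorems.BalabanUVNodesN19JointLawBernstein (abs_integral_prod_eval_sub_le integrable_of_continuous_of_cube)
open Summit.QuantumFields.YangMills.Theorems.BalabanUVNodesN19LawPriceJackson (sum_abs_coeff_X_mul_le sum_abs_coeff_one sum_abs_coeff_C_mul)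
open Summit.QuantumFields.YangMills.Theorems.BalabanUVNodesN19DiscreteJacksonPricing (sum_abs_coeff_finsetSum_le)
open Summit.QuantumFields.YangMills.Theorems.BalabanUVNodesN19JointLawPriceRidge (prod_apply_eq_prod_pow_card)

variable {ι : Type*} [Fintype ι] [DecidableEq ι]

/-! ## §1 Coefficient mass `Λ_d(q) = Σ_{k ≤ d}|[x^k]q|` is submultiplicative [folklore] -/

omit [Fintype ι] [DecidableEq ι] in
/-- `Λ_d(X^k·q) ≤ Λ_d(q)`. [bookkeeping] -/
theorem sum_abs_coeff_X_pow_mul_le (q : ℝ[X]) (k d : ℕ) :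
    ∑ i ∈ range (d + 1), |(X ^ k * q).coeff i| ≤ ∑ i ∈ range (d + 1), |q.coeff i| := by
  induction k with
  | zero => simp
  | succ k ih =>
      rw [pow_succ', mul_assoc]
      exact (sum_abs_coeff_X_mul_le _ d).trans ih

omit [Fintype ι] [DecidableEq ι] in
/-- ★ SUBMULTIPLICATIVITY: `Λ_d(p·q) ≤ Λ_a(p)·Λ_d(q)` whenever `deg p ≤ a` (any truncation `d`). [folklore] -/
theorem sum_abs_coeff_mul_le (p q : ℝ[X]) {a : ℕ} (hp : p.natDegree ≤ a) (d : ℕ) :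
    ∑ i ∈ range (d + 1), |(p * q).coeff i| ≤ (∑ i ∈ range (a + 1), |p.coeff i|) * ∑ i ∈ range (d + 1), |q.coeff i| := by
  have hpsum : p = ∑ i ∈ range (a + 1), C (p.coeff i) * X ^ i := p.as_sum_range_C_mul_X_pow' (Nat.lt_succ_of_le hp)
  have hmul : p * q = ∑ i ∈ range (a + 1), C (p.coeff i) * (X ^ i * q) := by
    conv_lhs => rw [hpsum]
    rw [Finset.sum_mul]
    exact Finset.sum_congr rfl fun i _ => by rw [mul_assoc]
  rw [hmul, Finset.sum_mul]
  refine (sum_abs_coeff_finsetSum_le _ _ d).trans (Finset.sum_le_sum fun i _ => ?_)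
  rw [sum_abs_coeff_C_mul]
  exact mul_le_mul_of_nonneg_left (sum_abs_coeff_X_pow_mul_le q i d) (abs_nonneg _)

omit [Fintype ι] [DecidableEq ι] in
/-- `Λ_d(p^c) ≤ Λ_a(p)^c` whenever `deg p ≤ a`. [bookkeeping] -/
theorem sum_abs_coeff_pow_le (p : ℝ[X]) {a : ℕ} (hp : p.natDegree ≤ a) (c d : ℕ) :
    ∑ i ∈ range (d + 1), |(p ^ c).coeff i| ≤ (∑ i ∈ range (a + 1), |p.coeff i|) ^ c := by
  induction c with
  | zero => rw [pow_zero, pow_zero, sum_abs_coeff_one]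
  | succ c ih =>
      rw [pow_succ', pow_succ']
      exact (sum_abs_coeff_mul_le p _ hp d).trans
        (mul_le_mul_of_nonneg_left ih (Finset.sum_nonneg fun _ _ => abs_nonneg _))

/-! ## §2 Powers of an additive polynomial statistic under `r`-close mixed moments [folklore] -/

/-- `S^n = Σ_{f : Fin n → ι} ∏_i p_i(x_i)^{#f⁻¹(i)}` for `S(x) = Σ_i p_i(x_i)`. [bookkeeping] -/
theorem statPow_eq_sum (p : ι → ℝ[X]) (x : ι → ℝ) (n : ℕ) :
    (∑ i, (p i).eval (x i)) ^ n = ∑ f : Fin n → ι, ∏ i, ((p i) ^ (Finset.univ.filter fun k => f k = i).card).eval (x i) := by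
  have h1 : (∑ i, (p i).eval (x i)) ^ n = ∏ _k : Fin n, ∑ i, (p i).eval (x i) := by
    rw [Finset.prod_const, Finset.card_univ, Fintype.card_fin]
  rw [h1, Finset.prod_univ_sum (fun _ : Fin n => (Finset.univ : Finset ι)) (fun _ i => (p i).eval (x i)), Fintype.piFinset_univ]
  refine Finset.sum_congr rfl fun f _ => ?_
  rw [prod_apply_eq_prod_pow_card f (fun i => (p i).eval (x i))]
  exact Finset.prod_congr rfl fun i _ => by rw [eval_pow]

/-- The fibre cardinalities of `f : Fin n → ι` sum to `n`. [bookkeeping] -/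
theorem sum_card_fiber {n : ℕ} (f : Fin n → ι) : ∑ i, (Finset.univ.filter fun k => f k = i).card = n := by
  have h := Finset.card_eq_sum_card_fiberwise (f := f) (s := (Finset.univ : Finset (Fin n))) (t := (Finset.univ : Finset ι))
    (fun k _ => Finset.mem_coe.2 (Finset.mem_univ (f k)))
  rw [Finset.card_univ, Fintype.card_fin] at h
  exact h.symm

/-- ★ **POWERS OF THE STATISTIC.**  `P, Q` on `[−1,1]^ι` with ALL mixed moments `r`-close (`0 ≤ r`); `p_i` of degree `≤ D` with coefficient mass
`Λ_D(p_i) ≤ Λ`.  Then `|∫(Σ_i p_i(x_i))^n dP − ∫(Σ_i p_i(x_i))^n dQ| ≤ (dΛ)^n·r` for every `n`. [folklore] -/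
theorem abs_integral_statPow_sub_le {P Q : Measure (ι → ℝ)} [IsProbabilityMeasure P] [IsProbabilityMeasure Q]
    (hP : P (Set.pi Set.univ (fun _ : ι => Set.Icc (-1 : ℝ) 1))ᶜ = 0) (hQ : Q (Set.pi Set.univ (fun _ : ι => Set.Icc (-1 : ℝ) 1))ᶜ = 0)
    {r : ℝ} (hr : 0 ≤ r) (hmom : ∀ j : ι → ℕ, |∫ x, ∏ i, x i ^ j i ∂P - ∫ x, ∏ i, x i ^ j i ∂Q| ≤ r)
    (p : ι → ℝ[X]) {D : ℕ} (hp : ∀ i, (p i).natDegree ≤ D) {Λ : ℝ}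
    (hΛ : ∀ i, ∑ k ∈ range (D + 1), |(p i).coeff k| ≤ Λ) (n : ℕ) :
    |∫ x, (∑ i, (p i).eval (x i)) ^ n ∂P - ∫ x, (∑ i, (p i).eval (x i)) ^ n ∂Q| ≤ ((Fintype.card ι : ℝ) * Λ) ^ n * r := by
  classical
  have hcont : ∀ f : Fin n → ι,
      Continuous fun x : ι → ℝ => ∏ i, ((p i) ^ (Finset.univ.filter fun k => f k = i).card).eval (x i) := fun f =>
    continuous_finsetProd _ fun i _ => (Polynomial.continuous _).comp (continuous_apply i)
  have hexp : ∀ (μ : Measure (ι → ℝ)) [IsProbabilityMeasure μ], μ (Set.pi Set.univ (fun _ : ι => Set.Icc (-1 : ℝ) 1))ᶜ = 0 →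
      ∫ x, (∑ i, (p i).eval (x i)) ^ n ∂μ =
        ∑ f : Fin n → ι, ∫ x, ∏ i, ((p i) ^ (Finset.univ.filter fun k => f k = i).card).eval (x i) ∂μ := by
    intro μ _ hμ
    have hfun : (fun x : ι → ℝ => (∑ i, (p i).eval (x i)) ^ n) =
        fun x => ∑ f : Fin n → ι, ∏ i, ((p i) ^ (Finset.univ.filter fun k => f k = i).card).eval (x i) := by
      funext x; exact statPow_eq_sum p x n
    rw [hfun, integral_finsetSum _ (fun f _ => integrable_of_continuous_of_cube hμ (hcont f))]
  have hmom' : ∀ j : ι → Fin (n * D + 1), |∫ x, ∏ i, x i ^ (j i : ℕ) ∂P - ∫ x, ∏ i, x i ^ (j i : ℕ) ∂Q| ≤ r :=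
    fun j => hmom fun i => (j i : ℕ)
  rw [hexp P hP, hexp Q hQ, ← Finset.sum_sub_distrib]
  calc |∑ f : Fin n → ι, (∫ x, ∏ i, ((p i) ^ (Finset.univ.filter fun k => f k = i).card).eval (x i) ∂P -
          ∫ x, ∏ i, ((p i) ^ (Finset.univ.filter fun k => f k = i).card).eval (x i) ∂Q)|
      ≤ ∑ f : Fin n → ι, |∫ x, ∏ i, ((p i) ^ (Finset.univ.filter fun k => f k = i).card).eval (x i) ∂P -
          ∫ x, ∏ i, ((p i) ^ (Finset.univ.filter fun k => f k = i).card).eval (x i) ∂Q| := abs_sum_le_sum_abs _ _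
    _ ≤ ∑ _f : Fin n → ι, Λ ^ n * r := Finset.sum_le_sum fun f _ => by
        have hcard : ∀ i, (Finset.univ.filter fun k => f k = i).card ≤ n := fun i =>
          (Finset.card_filter_le _ _).trans (by rw [Finset.card_univ, Fintype.card_fin])
        have hdeg : ∀ i, ((p i) ^ (Finset.univ.filter fun k => f k = i).card).natDegree ≤ n * D := fun i =>
          Polynomial.natDegree_pow_le.trans (Nat.mul_le_mul (hcard i) (hp i))
        have h := abs_integral_prod_eval_sub_le hP hQ hmom' (fun i => (p i) ^ (Finset.univ.filter fun k => f k = i).card) hdeg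
        refine h.trans (mul_le_mul_of_nonneg_right ?_ hr)
        calc ∏ i, ∑ l ∈ range (n * D + 1), |((p i) ^ (Finset.univ.filter fun k => f k = i).card).coeff l|
            ≤ ∏ i, Λ ^ (Finset.univ.filter fun k => f k = i).card :=
              Finset.prod_le_prod (fun i _ => Finset.sum_nonneg fun _ _ => abs_nonneg _) fun i _ =>
                (sum_abs_coeff_pow_le (p i) (hp i) _ _).trans
                  (pow_le_pow_left₀ (Finset.sum_nonneg fun _ _ => abs_nonneg _) (hΛ i) _)
          _ = Λ ^ n := by rw [Finset.prod_pow_eq_pow_sum, sum_card_fiber]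
    _ = ((Fintype.card ι : ℝ) * Λ) ^ n * r := by
        rw [Finset.sum_const, Finset.card_univ, Fintype.card_fun, Fintype.card_fin, nsmul_eq_mul, mul_pow]
        push_cast
        ring

/-! ## §3 ★★ A Lipschitz link of the statistic is priced LINEARLY in `d` [folklore] -/

omit [DecidableEq ι] in
/-- On the cube the statistic is bounded by `d·B`. [bookkeeping] -/
theorem abs_stat_le {p : ι → ℝ[X]} {B : ℝ} (hB : ∀ (i : ι) (s : ℝ), s ∈ Set.Icc (-1 : ℝ) 1 → |(p i).eval s| ≤ B)
    {x : ι → ℝ} (hx : ∀ i, x i ∈ Set.Icc (-1 : ℝ) 1) : |∑ i, (p i).eval (x i)| ≤ Fintype.card ι * B :=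
  calc |∑ i, (p i).eval (x i)| ≤ ∑ i, |(p i).eval (x i)| := abs_sum_le_sum_abs _ _
    _ ≤ ∑ _i : ι, B := Finset.sum_le_sum fun i _ => hB i _ (hx i)
    _ = Fintype.card ι * B := by rw [Finset.sum_const, Finset.card_univ, nsmul_eq_mul]

/-- ★★ **LIPSCHITZ LINKS OF ADDITIVE POLYNOMIAL STATISTICS: `2πK_h dB∕m + G_h·m9^m·(Λ∕B)^{2m}·r`.**  `P, Q` on `[−1,1]^ι` with all mixed moments
`r`-close (`0 ≤ r`); `p_i` of degree `≤ D`, coefficient mass `Λ_D(p_i) ≤ Λ`, `|p_i| ≤ B` on `[−1,1]` with `0 < B ≤ Λ`; `h` continuous, `K`-Lipschitz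
and `G`-bounded on `[−dB, dB]`.  Then for every `m ≥ 1`:
`|∫h(Σ_i p_i(x_i)) dP − ∫h(Σ_i p_i(x_i)) dQ| ≤ 2K(dB)(π∕m) + G·(m·9^m)·((Λ∕B)^{2m} r)` — the push-forwards under `S∕(dB)` have `j`-th moments
`(Λ∕B)^j r`-close (§2) and module 63's cut-off Jackson bound prices the profile `s ↦ h(dBs)`.  LINEAR in `d`. [folklore] -/
theorem law_price_link_le_of_uniformMixedMoments [Nonempty ι] {P Q : Measure (ι → ℝ)} [IsProbabilityMeasure P] [IsProbabilityMeasure Q]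
    (hP : P (Set.pi Set.univ (fun _ : ι => Set.Icc (-1 : ℝ) 1))ᶜ = 0) (hQ : Q (Set.pi Set.univ (fun _ : ι => Set.Icc (-1 : ℝ) 1))ᶜ = 0)
    {r : ℝ} (hr : 0 ≤ r) (hmom : ∀ j : ι → ℕ, |∫ x, ∏ i, x i ^ j i ∂P - ∫ x, ∏ i, x i ^ j i ∂Q| ≤ r)
    (p : ι → ℝ[X]) {D : ℕ} (hp : ∀ i, (p i).natDegree ≤ D) {Λ B : ℝ} (hB0 : 0 < B) (hBΛ : B ≤ Λ)
    (hΛ : ∀ i, ∑ k ∈ range (D + 1), |(p i).coeff k| ≤ Λ) (hB : ∀ (i : ι) (s : ℝ), s ∈ Set.Icc (-1 : ℝ) 1 → |(p i).eval s| ≤ B)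
    {h : ℝ → ℝ} (hh : Continuous h) {K G : ℝ} (hK0 : 0 ≤ K)
    (hK : ∀ s s' : ℝ, s ∈ Set.Icc (-(Fintype.card ι * B)) (Fintype.card ι * B) →
      s' ∈ Set.Icc (-(Fintype.card ι * B)) (Fintype.card ι * B) → |h s - h s'| ≤ K * |s - s'|)
    (hG : ∀ s : ℝ, s ∈ Set.Icc (-(Fintype.card ι * B)) (Fintype.card ι * B) → |h s| ≤ G) {m : ℕ} (hm : 0 < m) :
    |∫ x, h (∑ i, (p i).eval (x i)) ∂P - ∫ x, h (∑ i, (p i).eval (x i)) ∂Q| ≤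
      2 * (K * (Fintype.card ι * B)) * (π / m) + G * (m * 9 ^ m) * ((Λ / B) ^ (2 * m) * r) := by
  set d : ℕ := Fintype.card ι with hd
  have hdpos : (0 : ℝ) < d := by exact_mod_cast (Fintype.card_pos : 0 < d)
  set A : ℝ := d * B with hA
  have hA0 : 0 < A := mul_pos hdpos hB0
  have hΛ0 : 0 ≤ Λ := hB0.le.trans hBΛ
  have hΛB : 1 ≤ Λ / B := (one_le_div hB0).2 hBΛ
  set u : (ι → ℝ) → ℝ := fun x => (∑ i, (p i).eval (x i)) / A with hu
  have hSc : Continuous fun x : ι → ℝ => ∑ i, (p i).eval (x i) :=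
    continuous_finsetSum _ fun i _ => (Polynomial.continuous _).comp (continuous_apply i)
  have huc : Continuous u := hSc.div_const _
  haveI : IsProbabilityMeasure (P.map u) := Measure.isProbabilityMeasure_map huc.measurable.aemeasurable
  haveI : IsProbabilityMeasure (Q.map u) := Measure.isProbabilityMeasure_map huc.measurable.aemeasurable
  -- carried by `[−1,1]`
  have hcarry : ∀ (μ : Measure (ι → ℝ)), μ (Set.pi Set.univ (fun _ : ι => Set.Icc (-1 : ℝ) 1))ᶜ = 0 →
      (μ.map u) (Set.Icc (-1 : ℝ) 1)ᶜ = 0 := by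
    intro μ hμ
    rw [Measure.map_apply huc.measurable measurableSet_Icc.compl]
    refine measure_mono_null (fun x hx => ?_) hμ
    intro hxc
    apply hx
    have hb := abs_stat_le (p := p) hB (fun i => Set.mem_univ_pi.1 hxc i)
    show (∑ i, (p i).eval (x i)) / A ∈ Set.Icc (-1 : ℝ) 1
    rw [Set.mem_Icc, ← abs_le, abs_div, abs_of_pos hA0, div_le_one hA0]
    exact hb
  -- integration against the push-forward
  have hint : ∀ (μ : Measure (ι → ℝ)) {g : ℝ → ℝ}, Continuous g → ∫ s, g s ∂(μ.map u) = ∫ x, g (u x) ∂μ :=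
    fun μ g hg => integral_map huc.measurable.aemeasurable hg.aestronglyMeasurable
  -- the profile
  set g : ℝ → ℝ := fun s => h (A * s) with hg
  have hgc : Continuous g := hh.comp (continuous_const.mul continuous_id)
  have hAs : ∀ s : ℝ, s ∈ Set.Icc (-1 : ℝ) 1 → A * s ∈ Set.Icc (-((d : ℝ) * B)) (d * B) := fun s hs =>
    ⟨by rw [hA] at *; nlinarith [hs.1, hA0], by nlinarith [hs.2, hA0]⟩
  have hgK : ∀ s s' : ℝ, s ∈ Set.Icc (-1 : ℝ) 1 → s' ∈ Set.Icc (-1 : ℝ) 1 → |g s - g s'| ≤ K * A * |s - s'| := by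
    intro s s' hs hs'
    calc |g s - g s'| = |h (A * s) - h (A * s')| := rfl
      _ ≤ K * |A * s - A * s'| := hK _ _ (hAs s hs) (hAs s' hs')
      _ = K * A * |s - s'| := by rw [← mul_sub, abs_mul, abs_of_pos hA0]; ring
  have hgG : ∀ s : ℝ, s ∈ Set.Icc (-1 : ℝ) 1 → |g s| ≤ G := fun s hs => hG _ (hAs s hs)
  -- the moments of the push-forwards
  have hmomu : ∀ j : ℕ, j ≤ 2 * m → |∫ s, s ^ j ∂(P.map u) - ∫ s, s ^ j ∂(Q.map u)| ≤ (Λ / B) ^ (2 * m) * r := by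
    intro j hj
    rw [hint P (continuous_pow j), hint Q (continuous_pow j)]
    have hdiv : ∀ μ : Measure (ι → ℝ), ∫ x, (u x) ^ j ∂μ = (∫ x, (∑ i, (p i).eval (x i)) ^ j ∂μ) / A ^ j := by
      intro μ; simp only [hu, div_pow]; rw [integral_div]
    rw [hdiv P, hdiv Q, ← sub_div, abs_div, abs_of_pos (pow_pos hA0 j), div_le_iff₀ (pow_pos hA0 j)]
    calc |∫ x, (∑ i, (p i).eval (x i)) ^ j ∂P - ∫ x, (∑ i, (p i).eval (x i)) ^ j ∂Q| ≤ ((d : ℝ) * Λ) ^ j * r :=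
          abs_integral_statPow_sub_le hP hQ hr hmom p hp hΛ j
      _ = (Λ / B) ^ j * r * A ^ j := by
          rw [hA, mul_pow, mul_pow, div_pow]
          field_simp
      _ ≤ (Λ / B) ^ (2 * m) * r * A ^ j :=
          mul_le_mul_of_nonneg_right (mul_le_mul_of_nonneg_right (pow_le_pow_right₀ hΛB hj) hr) (pow_pos hA0 j).le
  have hr' : 0 ≤ (Λ / B) ^ (2 * m) * r := mul_nonneg (pow_nonneg (div_nonneg hΛ0 hB0.le) _) hr
  have hprice := abs_integral_sub_integral_le_of_moments_jackson (μ := Q.map u) (ν := P.map u)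
    (hcarry Q hQ) (hcarry P hP) hm hr' hmomu hgc (mul_nonneg hK0 hA0.le) hgK hgG
  have hback : ∀ μ : Measure (ι → ℝ), ∫ s, g s ∂(μ.map u) = ∫ x, h (∑ i, (p i).eval (x i)) ∂μ := by
    intro μ
    rw [hint μ hgc]
    refine integral_congr_ae (Filter.Eventually.of_forall fun x => ?_)
    simp only [hg, hu, mul_div_cancel₀ _ hA0.ne']
  rw [hback P, hback Q] at hprice
  simpa only [hA] using hprice

/-- ★ **THE SAME AT SMALL `r`: `(2πK dB + G)∕m`.**  If moreover `r ≤ (m²·9^m·(Λ∕B)^{2m})⁻¹` then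
`|∫h(Σ_i p_i(x_i)) dP − ∫h(Σ_i p_i(x_i)) dQ| ≤ (2πK·dB + G)∕m` — i.e. `≍ d·B·K·log(9Λ²∕B²)∕log r⁻¹`: LINEAR in `d`, the inner complexity enters only
through `log(Λ∕B)`. [folklore] -/
theorem law_price_link_le_of_small [Nonempty ι] {P Q : Measure (ι → ℝ)} [IsProbabilityMeasure P] [IsProbabilityMeasure Q]
    (hP : P (Set.pi Set.univ (fun _ : ι => Set.Icc (-1 : ℝ) 1))ᶜ = 0) (hQ : Q (Set.pi Set.univ (fun _ : ι => Set.Icc (-1 : ℝ) 1))ᶜ = 0)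
    {r : ℝ} (hr : 0 ≤ r) (hmom : ∀ j : ι → ℕ, |∫ x, ∏ i, x i ^ j i ∂P - ∫ x, ∏ i, x i ^ j i ∂Q| ≤ r)
    (p : ι → ℝ[X]) {D : ℕ} (hp : ∀ i, (p i).natDegree ≤ D) {Λ B : ℝ} (hB0 : 0 < B) (hBΛ : B ≤ Λ)
    (hΛ : ∀ i, ∑ k ∈ range (D + 1), |(p i).coeff k| ≤ Λ) (hB : ∀ (i : ι) (s : ℝ), s ∈ Set.Icc (-1 : ℝ) 1 → |(p i).eval s| ≤ B)
    {h : ℝ → ℝ} (hh : Continuous h) {K G : ℝ} (hK0 : 0 ≤ K)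
    (hK : ∀ s s' : ℝ, s ∈ Set.Icc (-(Fintype.card ι * B)) (Fintype.card ι * B) →
      s' ∈ Set.Icc (-(Fintype.card ι * B)) (Fintype.card ι * B) → |h s - h s'| ≤ K * |s - s'|)
    (hG : ∀ s : ℝ, s ∈ Set.Icc (-(Fintype.card ι * B)) (Fintype.card ι * B) → |h s| ≤ G) {m : ℕ} (hm : 0 < m)
    (hsmall : r ≤ 1 / ((m : ℝ) ^ 2 * 9 ^ m * (Λ / B) ^ (2 * m))) :
    |∫ x, h (∑ i, (p i).eval (x i)) ∂P - ∫ x, h (∑ i, (p i).eval (x i)) ∂Q| ≤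
      (2 * π * K * (Fintype.card ι * B) + G) / m := by
  have h1 := law_price_link_le_of_uniformMixedMoments hP hQ hr hmom p hp hB0 hBΛ hΛ hB hh hK0 hK hG hm
  have hmr : (0 : ℝ) < m := by exact_mod_cast hm
  have hdB : (0 : ℝ) ≤ Fintype.card ι * B := mul_nonneg (Nat.cast_nonneg _) hB0.le
  have hG0 : 0 ≤ G := (abs_nonneg _).trans (hG 0 ⟨by linarith, hdB⟩)
  have hq : 0 < (Λ / B) ^ (2 * m) := pow_pos (div_pos (hB0.trans_le hBΛ) hB0) _
  have h9 : (0 : ℝ) < 9 ^ m := by positivity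
  have hterm : G * (m * 9 ^ m) * ((Λ / B) ^ (2 * m) * r) ≤ G / m := by
    have hx : (m * 9 ^ m) * ((Λ / B) ^ (2 * m) * r) ≤ 1 / m := by
      calc (m * 9 ^ m) * ((Λ / B) ^ (2 * m) * r) ≤ (m * 9 ^ m) * ((Λ / B) ^ (2 * m) * (1 / ((m : ℝ) ^ 2 * 9 ^ m * (Λ / B) ^ (2 * m)))) :=
            mul_le_mul_of_nonneg_left (mul_le_mul_of_nonneg_left hsmall hq.le) (by positivity)
        _ = 1 / m := by field_simp
    calc G * (m * 9 ^ m) * ((Λ / B) ^ (2 * m) * r) = G * ((m * 9 ^ m) * ((Λ / B) ^ (2 * m) * r)) := by ring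
      _ ≤ G * (1 / m) := mul_le_mul_of_nonneg_left hx hG0
      _ = G / m := by rw [mul_one_div]
  calc |∫ x, h (∑ i, (p i).eval (x i)) ∂P - ∫ x, h (∑ i, (p i).eval (x i)) ∂Q|
      ≤ 2 * (K * (Fintype.card ι * B)) * (π / m) + G * (m * 9 ^ m) * ((Λ / B) ^ (2 * m) * r) := h1
    _ ≤ 2 * (K * (Fintype.card ι * B)) * (π / m) + G / m := add_le_add le_rfl hterm
    _ = (2 * π * K * (Fintype.card ι * B) + G) / m := by field_simp

end Summit.QuantumFields.YangMills.Theorems.BalabanUVNodesN19JointLawPriceCompositions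

end
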